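import Literature.NumberTheory.EllipticCurves.Kato2004.IwasawaH1Reduction
import Literature.NumberTheory.EllipticCurves.GreenbergSelmerDualDataExistsProofs
import HarnessLib

/-!
# Kato 2004 §13.8 «change of coefficients `T → T ⊗ 𝒪/p^k ⊂ A = T ⊗ F/𝒪`» for a framed representation with coefficients
# `𝒪 = padicCoeffIntegers S`: the map `T = 𝒪ⁿ → A = Fⁿ/𝒪ⁿ`, `t ↦ p^{-k} t mod 𝒪ⁿ`, and the induced reduction
# `H¹(U, T_ρ) → H¹(U, A_ρ)` on continuous cochains (the coefficient twin of `Kato2004.reduceH1Pk`)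

Topic `NumberTheory/EllipticCurves`, namespace `Literature.NumberTheory.EllipticCurves.GreenbergSelmer` (where `Cofree` lives). Written by the
lead prover of route `ResidualThetaTransportAtTwo` (cell `bsd-wall`, seat `bsd-wall-rtt-p2` g16) as item D1 of the pin spec
`Summits/…/Cruxes/ResidualThetaCountLowerPureAtTwo/PIN-SPEC-S2-g16.md` (the `ρ`-coefficient layer Tate pairing through `Θ` for crux RSL_g
stmt-BirchSwinnertonDyer-22608): every variant of that pairing (𝒪-valued or `ℤ₂`-valued) first needs the compact-to-discrete reduction of Kato
classes `H¹(U, T_ρ) → H¹(U, A_ρ[p^k]) ⊂ H¹(U, A_ρ)`. DEFINITIONS WITH BODIES and proved lemmas only; no named fact, no instance, no notation;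
nothing about BSD.

## Design
For `ρ : FramedRep G 𝒪 n` (`𝒪 = padicCoeffIntegers S ⊂ ℚ̄_p`, `F = padicCoeffField S = ℚ_p(S)`) the tree has the lattice `T_ρ = 𝒪ⁿ` with its
continuous representation `FramedRep.toContinuousRep ρ` (= `FramedGaloisRep.toGaloisRep`) and the DISCRETE divisible module
`A_ρ = Cofree ρ F = Fⁿ/𝒪ⁿ` (`cofreeMk`, `fracRepresentation`, `instDistribMulActionCofree`), on which all Selmer sets of the RSL_g crux are written
(`subgroupH1 U (Cofree ρ F)`). Instead of introducing a new finite module `T_ρ/p^k`, the reduction lands in `A_ρ` itself through the canonical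
identification `T/p^k T ≅ A[p^k]`, `t ↦ p^{-k} t mod T`:
* `divPowCofreeMk S ρ k : (Fin n → 𝒪) →+ Cofree ρ F`, `t ↦ cofreeMk (p^{-k} · t)` — additive, `G`-equivariant (`divPowCofreeMk_smul`), continuous for
  the product topology on `𝒪ⁿ` and the discrete topology on `A_ρ` (`continuous_divPowCofreeMk`: its kernel `p^k 𝒪ⁿ = {‖t_i‖ ≤ ‖p^k‖}` is open —
  closed balls are open in the ultrametric `ℚ̄_p`), killed by `p^k` (`pow_smul_divPowCofreeMk`), tower relation `p • div_{k+1} = div_k`;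
* **`reduceH1CofreePk S ρ k U : H1 (FramedRep.toContinuousRep ρ) U →+ subgroupH1 U (Cofree ρ F)`** for `U ≤ Γ_ℚ` — `mapH1AddHom` along
  `divPowCofreeMk` (verbatim the construction of `Kato2004.reduceH1Pk` for `T_pW → W[p^k]`); cocycle formula; values killed by `p^k`.
NOT here: compatibility with `resLe` / `conjMap` / `layerCores` (one-liners from the `mapH1AddHom_*` lemmas when a consumer needs them), the pairing
itself (D2–D3 of the spec), anything about `p = 2` or elliptic curves.

References: K. Kato, Astérisque 295 (2004), §13.8 (pp. 228–229) [Kato2004Asterisque]; R. Greenberg, *Iwasawa theory for p-adic representations*,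
Adv. Stud. Pure Math. 17 (1989), §1 p. 98 (`A_p = V_p/T_p`) [Greenberg1989]; M. Emerton, R. Pollack, T. Weston, Invent. Math. 163 (2006), §3.1
[EmertonPollackWeston2006]; J.-P. Serre, *Galois Cohomology* (1997), I §2.2 [SerreGaloisCohomology1997].
-/

noncomputable section

open scoped Classical
open Field IsDedekindDomain
open Literature.NumberTheory.GaloisRepresentations
open _root_.Matrix

namespace Literature.NumberTheory.EllipticCurves.GreenbergSelmer

universe u

section DivPow

variable {p : ℕ} [Fact p.Prime] (S : Set (PadicAlgCl p)) {G : Type u} [Group G] [TopologicalSpace G] {n : ℕ}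
  (ρ : FramedRep G (padicCoeffIntegers S) n) (k : ℕ)

/-- **`t ↦ p^{-k}·t mod 𝒪ⁿ : T_ρ = 𝒪ⁿ → A_ρ = Fⁿ/𝒪ⁿ`** — the canonical map `T → T/p^kT ≅ A[p^k] ⊂ A` (Greenberg's `A_p = V_p/T_p`; Kato §13.8
change of coefficients `T → T/p^k`), as an additive map. [cite: Kato2004Asterisque, §13.8 (p. 228)] [cite: Greenberg1989, §1 p. 98] -/
def divPowCofreeMk : (Fin n → padicCoeffIntegers S) →+ Cofree ρ (padicCoeffField S) where
  toFun t := cofreeMk (padicCoeffField S) ρ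
    ((((p : padicCoeffField S)⁻¹) ^ k) • fun i ↦ algebraMap (padicCoeffIntegers S) (padicCoeffField S) (t i))
  map_zero' := by
    have : (fun i : Fin n ↦ algebraMap (padicCoeffIntegers S) (padicCoeffField S) ((0 : Fin n → padicCoeffIntegers S) i)) = 0 := by
      ext i; simp
    rw [this, smul_zero, map_zero]
  map_add' s t := by
    have : (fun i : Fin n ↦ algebraMap (padicCoeffIntegers S) (padicCoeffField S) ((s + t) i)) =
        (fun i ↦ algebraMap (padicCoeffIntegers S) (padicCoeffField S) (s i)) +
          fun i ↦ algebraMap (padicCoeffIntegers S) (padicCoeffField S) (t i) := by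
      ext i; simp
    rw [this, smul_add, map_add]

/-- Unfolding `divPowCofreeMk`. [cite: Kato2004Asterisque, §13.8 (p. 228)] -/
theorem divPowCofreeMk_apply (t : Fin n → padicCoeffIntegers S) :
    divPowCofreeMk S ρ k t = cofreeMk (padicCoeffField S) ρ
      ((((p : padicCoeffField S)⁻¹) ^ k) • fun i ↦ algebraMap (padicCoeffIntegers S) (padicCoeffField S) (t i)) :=
  rfl

/-- **`G`-equivariance**: `div (ρ(g)·t) = g • div t` (`ρ(g)` has entries in `𝒪`: `RingHom.map_mulVec`; the action on `Fⁿ` is `F`-linear).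
[cite: EmertonPollackWeston2006, §3.1] -/
theorem divPowCofreeMk_smul (g : G) (t : Fin n → padicCoeffIntegers S) :
    divPowCofreeMk S ρ k (((ρ g : GL (Fin n) (padicCoeffIntegers S)) : Matrix (Fin n) (Fin n) (padicCoeffIntegers S)) *ᵥ t) =
      g • divPowCofreeMk S ρ k t := by
  rw [divPowCofreeMk_apply, divPowCofreeMk_apply, smul_cofreeMk, fracRepresentation_apply_apply, Matrix.mulVec_smul]
  congr 2
  funext i
  exact RingHom.map_mulVec (algebraMap (padicCoeffIntegers S) (padicCoeffField S))
    ((ρ g : GL (Fin n) (padicCoeffIntegers S)) : Matrix (Fin n) (Fin n) (padicCoeffIntegers S)) t i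

/-- The norm of `p^k` in `ℚ̄_p` is positive (private helper). [folklore] -/
private theorem norm_natCast_pow_pos : 0 < ‖((p : PadicAlgCl p)) ^ k‖ := by
  rw [norm_pow]
  exact pow_pos (norm_pos_iff.mpr (Nat.cast_ne_zero.mpr (Fact.out : p.Prime).ne_zero)) k

/-- The structure map `𝒪 → F = ℚ_p(S)` followed by `F ⊂ ℚ̄_p` is the inclusion `𝒪 ⊂ ℚ̄_p` (private helper). [folklore] -/
private theorem coe_algebraMap_padicCoeffIntegers (x : padicCoeffIntegers S) :
    ((algebraMap (padicCoeffIntegers S) (padicCoeffField S) x : padicCoeffField S) : PadicAlgCl p) = (x : PadicAlgCl p) :=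
  rfl

/-- **The kernel of `div_k` contains the ball `{t | ∀ i, ‖t_i‖ ≤ ‖p^k‖}`** (then `p^{-k} t_i ∈ 𝒪`). [cite: Kato2004Asterisque, §13.8 (p. 228)] -/
theorem divPowCofreeMk_eq_zero_of_norm_le (t : Fin n → padicCoeffIntegers S)
    (ht : ∀ i, ‖((t i : padicCoeffIntegers S) : PadicAlgCl p)‖ ≤ ‖((p : PadicAlgCl p)) ^ k‖) :
    divPowCofreeMk S ρ k t = 0 := by
  rw [divPowCofreeMk_apply, ← LinearMap.mem_ker, ker_cofreeMk, mem_lattice_iff]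
  have hp : ((p : PadicAlgCl p)) ^ k ≠ 0 := norm_pos_iff.mp (norm_natCast_pow_pos (p := p) k)
  refine ⟨fun i ↦ ⟨((t i : padicCoeffIntegers S) : PadicAlgCl p) / (p : PadicAlgCl p) ^ k, ⟨?_, ?_⟩⟩, ?_⟩
  · exact div_mem (t i).2.1 (pow_mem (IntermediateField.natCast_mem _ p) k)
  · rw [norm_div]
    exact div_le_one_of_le₀ (ht i) (norm_nonneg _)
  · funext i
    apply Subtype.ext
    change (((t i : padicCoeffIntegers S) : PadicAlgCl p) / (p : PadicAlgCl p) ^ k) =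
      ((((((p : padicCoeffField S)⁻¹) ^ k) • fun j ↦ algebraMap (padicCoeffIntegers S) (padicCoeffField S) (t j)) i :
        padicCoeffField S) : PadicAlgCl p)
    rw [Pi.smul_apply, smul_eq_mul, IntermediateField.coe_mul, IntermediateField.coe_pow, IntermediateField.coe_inv,
      coe_algebraMap_padicCoeffIntegers, div_eq_inv_mul, inv_pow]
    rfl

/-- **Continuity of `div_k`** for the product topology on `𝒪ⁿ` and the DISCRETE topology on `A_ρ`: the kernel is an open subgroup (it contains
the open ball `{‖t_i‖ ≤ ‖p^k‖ ∀ i}` — closed balls are open in the ultrametric `ℚ̄_p` — and fibres are its translates).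
[cite: SerreGaloisCohomology1997, I §2.2] -/
theorem continuous_divPowCofreeMk : Continuous (divPowCofreeMk S ρ k) := by
  -- the open neighbourhood of `0` inside the kernel
  set B : Set (Fin n → padicCoeffIntegers S) :=
    {t | ∀ i, ‖((t i : padicCoeffIntegers S) : PadicAlgCl p)‖ ≤ ‖((p : PadicAlgCl p)) ^ k‖} with hB
  have hBopen : IsOpen B := by
    have : B = ⋂ i, (fun t : Fin n → padicCoeffIntegers S ↦ ((t i : padicCoeffIntegers S) : PadicAlgCl p)) ⁻¹'
        Metric.closedBall 0 ‖((p : PadicAlgCl p)) ^ k‖ := by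
      ext t; simp [hB, Metric.mem_closedBall, dist_zero_right]
    rw [this]
    refine isOpen_iInter_of_finite fun i ↦ ?_
    exact (IsUltrametricDist.isOpen_closedBall (0 : PadicAlgCl p) (norm_natCast_pow_pos (p := p) k).ne').preimage
      (continuous_subtype_val.comp (continuous_apply i))
  have hBker : ∀ t ∈ B, divPowCofreeMk S ρ k t = 0 := fun t ht ↦ divPowCofreeMk_eq_zero_of_norm_le S ρ k t ht
  -- continuity at every point from the translate `t₀ + B`
  refine continuous_iff_continuousAt.mpr fun t₀ ↦ ?_
  refine continuousAt_def.mpr fun V hV ↦ ?_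
  have hVpt : divPowCofreeMk S ρ k t₀ ∈ V := mem_of_mem_nhds hV
  refine Filter.mem_of_superset ((hBopen.add_left (s := {t₀})).mem_nhds ?_) fun t ht ↦ ?_
  · exact ⟨t₀, rfl, 0, fun i ↦ by simp, add_zero t₀⟩
  · obtain ⟨a, rfl, b, hb, rfl⟩ := ht
    change divPowCofreeMk S ρ k (a + b) ∈ V
    rw [map_add, hBker b hb, add_zero]
    exact hVpt

/-- **`p^k` kills `div_k`**: `p^k • div_k t = t mod 𝒪ⁿ = 0` (the image lies in `A[p^k]`). [cite: Greenberg1989, §1 p. 98] -/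
theorem pow_smul_divPowCofreeMk (t : Fin n → padicCoeffIntegers S) : p ^ k • divPowCofreeMk S ρ k t = 0 := by
  have hp : (p : padicCoeffField S) ≠ 0 := Nat.cast_ne_zero.mpr (Fact.out : p.Prime).ne_zero
  rw [divPowCofreeMk_apply, ← map_nsmul, ← Nat.cast_smul_eq_nsmul (padicCoeffField S), smul_smul, Nat.cast_pow, ← mul_pow,
    mul_inv_cancel₀ hp, one_pow, one_smul, ← LinearMap.mem_ker, ker_cofreeMk, mem_lattice_iff]
  exact ⟨t, rfl⟩

/-- **Tower relation**: `p • div_{k+1} t = div_k t`. [cite: Kato2004Asterisque, §13.8 (p. 228)] -/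
theorem smul_divPowCofreeMk_succ (t : Fin n → padicCoeffIntegers S) :
    p • divPowCofreeMk S ρ (k + 1) t = divPowCofreeMk S ρ k t := by
  have hp : (p : padicCoeffField S) ≠ 0 := Nat.cast_ne_zero.mpr (Fact.out : p.Prime).ne_zero
  rw [divPowCofreeMk_apply, divPowCofreeMk_apply, ← map_nsmul, ← Nat.cast_smul_eq_nsmul (padicCoeffField S), smul_smul, pow_succ',
    ← mul_assoc, mul_inv_cancel₀ hp, one_mul]

end DivPow

/-! ## The reduction on `H¹` -/

section Reduce

variable {p : ℕ} [Fact p.Prime] (S : Set (PadicAlgCl p)) {n : ℕ}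
  (ρ : FramedGaloisRep ℚ (padicCoeffIntegers S) n) (k : ℕ)

/-- Equivariance of `div_k` for the restricted representations `T_ρ|_U`, `A_ρ|_U` of a subgroup `U ≤ Γ_ℚ` (the hypothesis shape of
`mapH1AddHom`; twin of `Kato2004.tateModPk_subgroupRep`). [cite: Kato2004Asterisque, §13.8 (p. 228)] -/
theorem divPowCofreeMk_subgroupRep (U : Subgroup (absoluteGaloisGroup ℚ)) (u : U) (t : Fin n → padicCoeffIntegers S) :
    divPowCofreeMk S ρ k ((subgroupRep (FramedGaloisRep.toGaloisRep ρ).toTopRep U).ρ u t) =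
      (discreteTopRep U (Cofree ρ (padicCoeffField S))).ρ u (divPowCofreeMk S ρ k t) :=
  divPowCofreeMk_smul S ρ k (u : absoluteGaloisGroup ℚ) t

/-- **The levelwise reduction `red_{U,p^k} : H¹(U, T_ρ) → H¹(U, A_ρ)`**, `[φ] ↦ [p^{-k}·φ mod 𝒪ⁿ]`, for a subgroup `U ≤ Γ_ℚ` (`mapH1AddHom`
along `divPowCofreeMk`; source = Kato's `H1 ρ.toGaloisRep U` over `𝒪`, target = the tree's `subgroupH1 U (Cofree ρ F)` where the Selmer sets of
`A_ρ` live). The coefficient twin of `Kato2004.reduceH1Pk` (there `T_pW → W[p^k]`). [cite: Kato2004Asterisque, §13.8 (pp. 228–229)] -/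
def reduceH1CofreePk (U : Subgroup (absoluteGaloisGroup ℚ)) :
    H1 (FramedGaloisRep.toGaloisRep ρ) U →+ subgroupH1 U (Cofree ρ (padicCoeffField S)) :=
  mapH1AddHom (subgroupRep (FramedGaloisRep.toGaloisRep ρ).toTopRep U) (discreteTopRep U (Cofree ρ (padicCoeffField S)))
    (divPowCofreeMk S ρ k) (continuous_divPowCofreeMk S ρ k) (divPowCofreeMk_subgroupRep S ρ k U)

/-- `red_{p^k}` on explicit cocycles: `red [φ] = [div_k ∘ φ]`. [cite: Kato2004Asterisque, §13.8 (p. 228)] -/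
theorem reduceH1CofreePk_oneCocycleClass (U : Subgroup (absoluteGaloisGroup ℚ))
    (φ : contOneCocycles (subgroupRep (FramedGaloisRep.toGaloisRep ρ).toTopRep U)) :
    reduceH1CofreePk S ρ k U (oneCocycleClass _ φ) =
      oneCocycleClass _ (contOneCocycles.pushAddHom (divPowCofreeMk S ρ k) (continuous_divPowCofreeMk S ρ k)
        (divPowCofreeMk_subgroupRep S ρ k U) φ) :=
  mapH1AddHom_oneCocycleClass _ _ _ φ

/-- **The reduced classes are killed by `p^k`** (they live in the image of `H¹(U, A_ρ[p^k])`). [cite: Greenberg1989, §1 p. 98] -/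
theorem pow_smul_reduceH1CofreePk (U : Subgroup (absoluteGaloisGroup ℚ)) (c : H1 (FramedGaloisRep.toGaloisRep ρ) U) :
    p ^ k • reduceH1CofreePk S ρ k U c = 0 := by
  obtain ⟨φ, rfl⟩ := oneCocycleClass_surjective _ c
  rw [reduceH1CofreePk_oneCocycleClass]
  -- `n • [ψ] = [(n : ℤ) • ψ]` and the cocycle `(p^k) • (div_k ∘ φ)` vanishes pointwise
  set ψ : contOneCocycles (discreteTopRep U (Cofree ρ (padicCoeffField S))) :=
    contOneCocycles.pushAddHom (Y := discreteTopRep U (Cofree ρ (padicCoeffField S))) (divPowCofreeMk S ρ k)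
      (continuous_divPowCofreeMk S ρ k) (divPowCofreeMk_subgroupRep S ρ k U) φ with hψ
  have h := oneCocycleClass_smul (discreteTopRep U (Cofree ρ (padicCoeffField S))) ((p ^ k : ℕ) : ℤ) ψ
  conv at h => rhs; rw [Nat.cast_smul_eq_nsmul]
  rw [← h]
  have h0 : ((p ^ k : ℕ) : ℤ) • ψ = 0 := by
    apply Subtype.ext
    ext u
    change ((p ^ k : ℕ) : ℤ) • ψ.1 u = 0
    rw [natCast_zsmul, hψ, contOneCocycles.pushAddHom_apply, pow_smul_divPowCofreeMk]
  rw [h0, oneCocycleClass_zero]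

end Reduce

/-! ## (appended) The reduction with values in the `p^k`-torsion `A_ρ[p^k]` — the FINITE coefficient module on which the layer
Tate pairing lives (PIN-SPEC-S2 D2) -/

section Torsion

variable {p : ℕ} [Fact p.Prime] (S : Set (PadicAlgCl p)) {n : ℕ}
  (ρ : FramedGaloisRep ℚ (padicCoeffIntegers S) n) (k : ℕ)

/-- **`t ↦ p^{-k}·t mod 𝒪ⁿ` with values in `A_ρ[p^k]`** (`T/p^kT ≅ A[p^k]`; codomain restricted by `pow_smul_divPowCofreeMk`).
[cite: Kato2004Asterisque, §13.8 (p. 228)] [cite: Greenberg1989, §1 p. 98] -/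
def divPowCofreeMkTorsion :
    (Fin n → padicCoeffIntegers S) →+ ↥(AddSubgroup.torsionBy (Cofree ρ (padicCoeffField S)) ((p ^ k : ℕ) : ℤ)) where
  toFun t := ⟨divPowCofreeMk S ρ k t, by
    rw [AddSubgroup.torsionBy, Submodule.mem_toAddSubgroup, Submodule.mem_torsionBy_iff, natCast_zsmul]
    exact pow_smul_divPowCofreeMk S ρ k t⟩
  map_zero' := Subtype.ext (map_zero _)
  map_add' s t := Subtype.ext (map_add _ s t)

/-- Unfolding: the underlying point of `divPowCofreeMkTorsion t` is `divPowCofreeMk t`. [cite: Kato2004Asterisque, §13.8 (p. 228)] -/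
@[simp]
theorem coe_divPowCofreeMkTorsion_apply (t : Fin n → padicCoeffIntegers S) :
    ((divPowCofreeMkTorsion S ρ k t : ↥(AddSubgroup.torsionBy (Cofree ρ (padicCoeffField S)) ((p ^ k : ℕ) : ℤ))) : Cofree ρ (padicCoeffField S)) =
      divPowCofreeMk S ρ k t :=
  rfl

/-- Continuity of the torsion-valued reduction map (discrete target). [cite: SerreGaloisCohomology1997, I §2.2] -/
theorem continuous_divPowCofreeMkTorsion : Continuous (divPowCofreeMkTorsion S ρ k) :=
  Continuous.subtype_mk (continuous_divPowCofreeMk S ρ k) _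

/-- Equivariance of the torsion-valued reduction map for `T_ρ|_U`, `A_ρ[p^k]|_U`. [cite: Kato2004Asterisque, §13.8 (p. 228)] -/
theorem divPowCofreeMkTorsion_subgroupRep (U : Subgroup (absoluteGaloisGroup ℚ)) (u : U) (t : Fin n → padicCoeffIntegers S) :
    divPowCofreeMkTorsion S ρ k ((subgroupRep (FramedGaloisRep.toGaloisRep ρ).toTopRep U).ρ u t) =
      (discreteTopRep U ↥(AddSubgroup.torsionBy (Cofree ρ (padicCoeffField S)) ((p ^ k : ℕ) : ℤ))).ρ u (divPowCofreeMkTorsion S ρ k t) :=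
  Subtype.ext (divPowCofreeMk_smul S ρ k (u : absoluteGaloisGroup ℚ) t)

/-- **The levelwise reduction with FINITE coefficients `red_{U,p^k} : H¹(U, T_ρ) → H¹(U, A_ρ[p^k])`** (`mapH1AddHom` along
`divPowCofreeMkTorsion`) — the source of the layer Tate pairing for `ρ`-coefficients (cup product with a pairing `A_ρ[p^k] × A_ρ[p^k] → μ_{p^k}`).
[cite: Kato2004Asterisque, §13.8 (pp. 228–229)] -/
def reduceH1CofreePkTorsion (U : Subgroup (absoluteGaloisGroup ℚ)) :
    H1 (FramedGaloisRep.toGaloisRep ρ) U →+ subgroupH1 U ↥(AddSubgroup.torsionBy (Cofree ρ (padicCoeffField S)) ((p ^ k : ℕ) : ℤ)) :=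
  mapH1AddHom (subgroupRep (FramedGaloisRep.toGaloisRep ρ).toTopRep U) (discreteTopRep U ↥(AddSubgroup.torsionBy (Cofree ρ (padicCoeffField S)) ((p ^ k : ℕ) : ℤ)))
    (divPowCofreeMkTorsion S ρ k) (continuous_divPowCofreeMkTorsion S ρ k) (divPowCofreeMkTorsion_subgroupRep S ρ k U)

/-- `red_{p^k}` with finite coefficients on explicit cocycles. [cite: Kato2004Asterisque, §13.8 (p. 228)] -/
theorem reduceH1CofreePkTorsion_oneCocycleClass (U : Subgroup (absoluteGaloisGroup ℚ))
    (φ : contOneCocycles (subgroupRep (FramedGaloisRep.toGaloisRep ρ).toTopRep U)) :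
    reduceH1CofreePkTorsion S ρ k U (oneCocycleClass _ φ) =
      oneCocycleClass _ (contOneCocycles.pushAddHom (divPowCofreeMkTorsion S ρ k) (continuous_divPowCofreeMkTorsion S ρ k)
        (divPowCofreeMkTorsion_subgroupRep S ρ k U) φ) :=
  mapH1AddHom_oneCocycleClass _ _ _ φ

end Torsion

end Literature.NumberTheory.EllipticCurves.GreenbergSelmer

end
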